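/-
Copyright (c) 2026. Released under Apache 2.0 license as described in the file LICENSE.
Track B ∕ K2-LIT (cell `hodgecm-mathlib`, squad K2, ENGINE E1), crux h413 = `stmt-HodgeConjecture-24833`, route of record `HCCMUnconditional`.
Prover seat `hodgecm-mathlib-K2E3-p12` (g6).  Deal «BL-P1» (K2E1-plan (g5) 08:32:53Z), file P1a: Bernstein–Lapid's principle of meromorphic continuation (global statement).
-/
import Summits.HodgeConjecture.HodgeConjecture.Theorems.K2E1MeromorphicSolutionPrincipleLocal   -- ★ P1a-loc (this seat): `exists_local_meromorphic_solution`, isolated-zeros bricks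
import Mathlib.Analysis.Meromorphic.Basic
import HarnessLib

/-!
# K2·E1 — `K2E1MeromorphicSolutionPrinciple`: BERNSTEIN–LAPID'S PRINCIPLE OF MEROMORPHIC CONTINUATION [arXiv:1911.02342, Thm 2.3] IN BANACH CURRENCY — an analytic system of linear
# equations of locally finite type on a connected open `D ⊆ ℂ`, with a unique solution on some non-empty open set, has a unique solution `v(s)` on an open dense `U ⊆ D`, holomorphic on
# `U` and MEROMORPHIC on `D` (locally `f·v = u`, `f ≢ 0`)

Track B ∕ K2-LIT, crux h413 = `stmt-HodgeConjecture-24833`, route of record `HCCMUnconditional`; cell `hodgecm-mathlib`, squad K2, ENGINE E1 (campaign EIS-R7-BL-SPH, RULING «RE-WIRE N=3»: the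
load-bearing functional analysis; consumers P8 assembly N = 2 and its N = 3 clone).  Prover seat `hodgecm-mathlib-K2E3-p12` (g6).  THEOREMS ONLY (no `def`, no `instance`, no notation, no
named-fact hypothesis, no `sorry`); lane `--supports stmt-HodgeConjecture-24833 --as helper` (count-neutral).  Closes no socket.  GENERIC — no automorphic content.

THE MATHEMATICS [BernsteinLapid2019, §2.1 (meromorphic := locally `g·f = h`, `g ≢ 0`), §2.3 Thm 2.3, §9].  Setting of ★ P1a-loc: `D ⊆ ℂ` open preconnected, `A : D → 𝓛(𝓥, 𝓦)` and `c : D → 𝓦`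
holomorphic (Banach `𝓥`, `𝓦`), ONE equation `A(s)v = c(s)` (finite systems: product codomain), LOCALLY OF FINITE TYPE in column form (`∀ s₀ ∈ D ∃` nbhd `W`, `n`, holomorphic columns
`e_j : W → 𝓥` with `Sol(s) ⊆ span{e_j(s)}`), and `∃ U₀ ⊆ D` open non-empty with `Sol(s)` a singleton for `s ∈ U₀`.  CONCLUSION: a function `v : ℂ → 𝓥` and an open `U ⊆ D` dense in `D` with
(i) `v` holomorphic on `U`; (ii) for `s ∈ U`, `Sol(s) = {v(s)}` (so `v` agrees on `U` with every branch of solutions — the consumer may redefine `v := E` on the Godement half-plane);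
(iii) `MeromorphicOn v D` (Mathlib); (iv) the B–L local form: around every `s₀ ∈ D` holomorphic `f`, `u` with `f ≠ 0` on a punctured neighbourhood and `f(s) ≠ 0 ⟹ s ∈ U ∧ f(s)v(s) = u(s)`
(what makes `φ(v(s))` meromorphic for every continuous functional `φ`).  PROOF: `M := {s ∈ D ∣ Sol(s)` singleton`}`; ★ P1a-loc at every `s₀ ∈ D ∩ closure(int M)` on a ball `B ⊆ D` with
`O := B ∩ int M` gives `f, u` with `{f ≠ 0} ∩ B ⊆ M` open, dense in `B` (isolated zeros) ⟹ `B ⊆ closure(int M)`: so `D ∩ closure(int M)` is open, closed in `D`, contains `U₀ ≠ ∅` ⟹ equals `D`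
(`D` preconnected); `U := ⋃_{s₀ ∈ D} (B_{s₀} ∩ {f_{s₀} ≠ 0})`; on each piece `v = f⁻¹•u`.
§1 **`exists_meromorphic_solution`** — Thm 2.3 with (i)–(iv).
HONEST LABEL: HC_CM is proved only modulo the 7 printed citations (2 remaining named inputs: hLiu418 = `stmt-HodgeConjecture-24832`, h413 = `stmt-HodgeConjecture-24833`) until rung 0
closes; this file asserts no named fact and closes no socket.  NOT claimed (B–L Remark after Thm 2.3): holomorphy of `v` on the whole interior of `M`.
References: [BernsteinLapid2019] arXiv:1911.02342 (JAMS 37 (2024), doi:10.1090/jams/1020) §2.1, §2.3 Thm 2.3, §9 · [ReedSimonI1980] Thm. VI.14.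
-/

set_option autoImplicit false
-- the mandated namespace repeats the single-problem summit's segment (`HodgeConjecture.HodgeConjecture`)
set_option linter.dupNamespace false

noncomputable section

open Filter Topology Set Submodule Module
open scoped Classical
open Summit.HodgeConjecture.HodgeConjecture.Cruxes.H413.K2E1MeromorphicSolutionPrincipleLocal

namespace Summit.HodgeConjecture.HodgeConjecture.Cruxes.H413.K2E1MeromorphicSolutionPrinciple

/-- **BERNSTEIN–LAPID, PRINCIPLE OF MEROMORPHIC CONTINUATION** [BernsteinLapid2019, Thm 2.3].  Let `D ⊆ ℂ` be open and preconnected, `𝓥`, `𝓦` complex Banach spaces, `A : D → 𝓛(𝓥, 𝓦)` and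
`c : D → 𝓦` holomorphic, the equation `A(s)v = c(s)` locally of finite type (holomorphic columns spanning a space containing every solution, near every point of `D`), and suppose the
solution is unique for `s` in some non-empty open `U₀ ⊆ D`.  Then there are `v : ℂ → 𝓥` and an open `U ⊆ D`, dense in `D`, with `v` holomorphic on `U`, `Sol(s) = {v(s)}` for every `s ∈ U`,
`v` meromorphic on `D` (Mathlib `MeromorphicOn`), and the local form: near every `s₀ ∈ D`, holomorphic `f`, `u` with `f ≠ 0` on a punctured neighbourhood of `s₀` and
`f(s) ≠ 0 ⟹ s ∈ U ∧ f(s)•v(s) = u(s)`. [cite: BernsteinLapid2019, Thm 2.3 and §9] [cite: ReedSimonI1980, Thm. VI.14] -/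
theorem exists_meromorphic_solution {𝓥 𝓦 : Type*} [NormedAddCommGroup 𝓥] [NormedSpace ℂ 𝓥] [CompleteSpace 𝓥] [NormedAddCommGroup 𝓦] [NormedSpace ℂ 𝓦] [CompleteSpace 𝓦]
    {D : Set ℂ} (hD : IsOpen D) (hDc : IsPreconnected D) {A : ℂ → 𝓥 →L[ℂ] 𝓦} (hA : DifferentiableOn ℂ A D) {c : ℂ → 𝓦} (hc : DifferentiableOn ℂ c D)
    (hfin : ∀ s₀ ∈ D, ∃ W ∈ 𝓝 s₀, ∃ n : ℕ, ∃ e : Fin n → ℂ → 𝓥, (∀ j, DifferentiableOn ℂ (e j) W) ∧ ∀ s ∈ W, ∀ v : 𝓥, A s v = c s → v ∈ span ℂ (Set.range fun j => e j s))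
    (hunq : ∃ U₀ : Set ℂ, IsOpen U₀ ∧ U₀.Nonempty ∧ U₀ ⊆ D ∧ ∀ s ∈ U₀, ∃! v : 𝓥, A s v = c s) :
    ∃ (v : ℂ → 𝓥) (U : Set ℂ), IsOpen U ∧ U ⊆ D ∧ D ⊆ closure U ∧ DifferentiableOn ℂ v U ∧
      (∀ s ∈ U, ∀ w : 𝓥, A s w = c s ↔ w = v s) ∧ MeromorphicOn v D ∧
      (∀ s₀ ∈ D, ∃ W ∈ 𝓝 s₀, ∃ (f : ℂ → ℂ) (u : ℂ → 𝓥), DifferentiableOn ℂ f W ∧ DifferentiableOn ℂ u W ∧ (∀ᶠ s in 𝓝[≠] s₀, f s ≠ 0) ∧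
        ∀ s ∈ W, f s ≠ 0 → s ∈ U ∧ f s • v s = u s) := by
  obtain ⟨U₀, hU₀o, hU₀ne, hU₀D, hU₀unq⟩ := hunq
  -- the candidate: the unique solution where there is one, `0` elsewhere
  obtain ⟨v, hv⟩ : ∃ v : ℂ → 𝓥, ∀ s, (∃! w, A s w = c s) → ∀ w, A s w = c s ↔ w = v s := by
    refine ⟨fun s => if h : ∃! w, A s w = c s then h.exists.choose else 0, fun s h w => ?_⟩
    beta_reduce
    rw [dif_pos h]
    exact ⟨fun hw => h.unique hw h.exists.choose_spec, fun hw => hw ▸ h.exists.choose_spec⟩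
  -- the set `M` where the solution is unique, and the local step at points of `D ∩ closure (interior M)`
  obtain ⟨M, hM⟩ : ∃ M : Set ℂ, M = {s | s ∈ D ∧ ∃! w, A s w = c s} := ⟨_, rfl⟩
  have hloc : ∀ s₀ ∈ D, s₀ ∈ closure (interior M) → ∃ ε : ℝ, 0 < ε ∧ Metric.ball s₀ ε ⊆ D ∧ ∃ (f : ℂ → ℂ) (u : ℂ → 𝓥),
      DifferentiableOn ℂ f (Metric.ball s₀ ε) ∧ DifferentiableOn ℂ u (Metric.ball s₀ ε) ∧ (∃ s ∈ Metric.ball s₀ ε, f s ≠ 0) ∧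
      ∀ s ∈ Metric.ball s₀ ε, f s ≠ 0 → s ∈ M ∧ f s • v s = u s := by
    intro s₀ hs₀ hcl
    obtain ⟨W, hW, n, e, he, hsolW⟩ := hfin s₀ hs₀
    obtain ⟨ε, hε, hball⟩ := Metric.mem_nhds_iff.1 (inter_mem hW (hD.mem_nhds hs₀))
    have hBW : Metric.ball s₀ ε ⊆ W := fun s hs => (hball hs).1
    have hBD : Metric.ball s₀ ε ⊆ D := fun s hs => (hball hs).2
    have hOne : (Metric.ball s₀ ε ∩ interior M).Nonempty := mem_closure_iff_nhds.1 hcl _ (Metric.ball_mem_nhds s₀ hε)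
    obtain ⟨f, u, hf, hu, hne, hspec⟩ := exists_local_meromorphic_solution Metric.isOpen_ball (convex_ball s₀ ε).isPreconnected (hA.mono hBD) (hc.mono hBD)
      (fun j => (he j).mono hBW) (fun s hs => hsolW s (hBW hs)) (Metric.isOpen_ball.inter isOpen_interior) Set.inter_subset_left hOne
      (fun s hs => by have h := interior_subset hs.2; rw [hM] at h; exact h.2)
    refine ⟨ε, hε, hBD, f, u, hf, hu, hne, fun s hs hfs => ?_⟩
    obtain ⟨v', hv', hfv⟩ := hspec s hs hfs
    have hex : ∃! w, A s w = c s := ⟨v', (hv' v').2 rfl, fun w hw => (hv' w).1 hw⟩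
    have hvs : v s = v' := (hv' (v s)).1 ((hv s hex (v s)).2 rfl)
    refine ⟨by rw [hM]; exact ⟨hBD hs, hex⟩, by rw [hvs]; exact hfv⟩
  -- density of the non-vanishing set of `f` in its ball
  have hclos : ∀ (s₀ : ℂ) (ε : ℝ) (f : ℂ → ℂ), DifferentiableOn ℂ f (Metric.ball s₀ ε) → (∃ s ∈ Metric.ball s₀ ε, f s ≠ 0) →
      ∀ x ∈ Metric.ball s₀ ε, (∀ᶠ z in 𝓝[≠] x, f z ≠ 0) ∧ x ∈ closure (Metric.ball s₀ ε ∩ f ⁻¹' {z | z ≠ 0}) := by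
    intro s₀ ε f hf ⟨s₁, hs₁, hf₁⟩ x hx
    have hev := eventually_ne_zero_of_analyticOnNhd (convex_ball s₀ ε).isPreconnected (hf.analyticOnNhd Metric.isOpen_ball) hs₁ hf₁ hx
    refine ⟨hev, ?_⟩
    rw [mem_closure_iff_frequently]
    have h2 : ∀ᶠ z in 𝓝[≠] x, z ∈ Metric.ball s₀ ε ∩ f ⁻¹' {z | z ≠ 0} :=
      (hev.and (mem_nhdsWithin_of_mem_nhds (Metric.isOpen_ball.mem_nhds hx))).mono fun z hz => ⟨hz.2, hz.1⟩
    exact h2.frequently.filter_mono nhdsWithin_le_nhds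
  -- clopen propagation: every point of `D` lies in `closure (interior M)`
  have hU₀M : U₀ ⊆ interior M := interior_maximal (fun s hs => by rw [hM]; exact ⟨hU₀D hs, hU₀unq s hs⟩) hU₀o
  have hall : ∀ s ∈ D, s ∈ closure (interior M) := by
    have hCo : IsOpen (D ∩ closure (interior M)) := by
      rw [isOpen_iff_mem_nhds]
      rintro s₀ ⟨hs₀D, hs₀c⟩
      obtain ⟨ε, hε, hBD, f, u, hf, -, hne, hspec⟩ := hloc s₀ hs₀D hs₀c
      refine mem_of_superset (Metric.ball_mem_nhds s₀ hε) fun x hx => ⟨hBD hx, ?_⟩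
      have hsub : Metric.ball s₀ ε ∩ f ⁻¹' {z | z ≠ 0} ⊆ interior M :=
        interior_maximal (fun s hs => (hspec s hs.1 hs.2).1) (hf.continuousOn.isOpen_inter_preimage Metric.isOpen_ball isOpen_ne)
      exact closure_mono hsub ((hclos s₀ ε f hf hne x hx).2)
    intro s hs
    by_contra hsc
    have h1 : D ⊆ (D ∩ closure (interior M)) ∪ (closure (interior M))ᶜ := fun x hx => by
      by_cases h : x ∈ closure (interior M)
      · exact Or.inl ⟨hx, h⟩
      · exact Or.inr h
    obtain ⟨x₀, hx₀⟩ := hU₀ne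
    obtain ⟨t, -, ⟨-, htc⟩, htc'⟩ := hDc _ _ hCo isClosed_closure.isOpen_compl h1 ⟨x₀, hU₀D hx₀, hU₀D hx₀, subset_closure (hU₀M hx₀)⟩ ⟨s, hs, hsc⟩
    exact htc' htc
  -- the open dense set `U := ⋃_{s₀ ∈ D} (B_{s₀} ∩ {f_{s₀} ≠ 0})`
  choose ε hε hBD f u hf hu hne hspec using fun s₀ (h : s₀ ∈ D) => hloc s₀ h (hall s₀ h)
  have hpo : ∀ s₀ (h : s₀ ∈ D), IsOpen (Metric.ball s₀ (ε s₀ h) ∩ f s₀ h ⁻¹' {z | z ≠ 0}) := fun s₀ h =>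
    (hf s₀ h).continuousOn.isOpen_inter_preimage Metric.isOpen_ball isOpen_ne
  -- on each piece `v = f⁻¹ • u`
  have hvf : ∀ s₀ (h : s₀ ∈ D), ∀ s ∈ Metric.ball s₀ (ε s₀ h) ∩ f s₀ h ⁻¹' {z | z ≠ 0}, v s = (f s₀ h s)⁻¹ • u s₀ h s := fun s₀ h s hs => by
    rw [← (hspec s₀ h s hs.1 hs.2).2, smul_smul, inv_mul_cancel₀ (show f s₀ h s ≠ 0 from hs.2), one_smul]
  refine ⟨v, ⋃ (s₀ : ℂ) (h : s₀ ∈ D), Metric.ball s₀ (ε s₀ h) ∩ f s₀ h ⁻¹' {z | z ≠ 0}, isOpen_iUnion fun s₀ => isOpen_iUnion fun h => hpo s₀ h,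
    Set.iUnion₂_subset fun s₀ h => fun s hs => hBD s₀ h hs.1, fun s₀ hs₀ => ?_, fun s hs => ?_, fun s hs => ?_, fun s₀ hs₀ => ?_, fun s₀ hs₀ => ?_⟩
  · -- `D ⊆ closure U`
    exact closure_mono (Set.subset_iUnion₂ (s := fun s₀ (h : s₀ ∈ D) => Metric.ball s₀ (ε s₀ h) ∩ f s₀ h ⁻¹' {z | z ≠ 0}) s₀ hs₀)
      ((hclos s₀ _ _ (hf s₀ hs₀) (hne s₀ hs₀) s₀ (Metric.mem_ball_self (hε s₀ hs₀))).2)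
  · -- `v` is holomorphic on `U`
    obtain ⟨s₀, h, hs'⟩ := Set.mem_iUnion₂.1 hs
    have hsB : Metric.ball s₀ (ε s₀ h) ∈ 𝓝 s := Metric.isOpen_ball.mem_nhds hs'.1
    have hdiff : DifferentiableAt ℂ (fun t => (f s₀ h t)⁻¹ • u s₀ h t) s :=
      (((hf s₀ h).differentiableAt hsB).inv hs'.2).smul ((hu s₀ h).differentiableAt hsB)
    refine (hdiff.congr_of_eventuallyEq (eventually_of_mem ((hpo s₀ h).mem_nhds hs') fun t ht => hvf s₀ h t ht)).differentiableWithinAt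
  · -- uniqueness on `U`
    obtain ⟨s₀, h, hs'⟩ := Set.mem_iUnion₂.1 hs
    have hsM := (hspec s₀ h s hs'.1 hs'.2).1
    rw [hM] at hsM
    exact hv s hsM.2
  · -- `MeromorphicOn v D`
    have hB : Metric.ball s₀ (ε s₀ hs₀) ∈ 𝓝 s₀ := Metric.ball_mem_nhds s₀ (hε s₀ hs₀)
    have hfa : AnalyticAt ℂ (f s₀ hs₀) s₀ := (hf s₀ hs₀).analyticOnNhd Metric.isOpen_ball s₀ (Metric.mem_ball_self (hε s₀ hs₀))
    have hua : AnalyticAt ℂ (u s₀ hs₀) s₀ := (hu s₀ hs₀).analyticOnNhd Metric.isOpen_ball s₀ (Metric.mem_ball_self (hε s₀ hs₀))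
    have hev := (hclos s₀ _ _ (hf s₀ hs₀) (hne s₀ hs₀) s₀ (Metric.mem_ball_self (hε s₀ hs₀))).1
    refine (hfa.meromorphicAt.inv.smul hua.meromorphicAt).congr ?_
    filter_upwards [hev, mem_nhdsWithin_of_mem_nhds hB] with z hz hzB
    rw [Pi.smul_apply', Pi.inv_apply, hvf s₀ hs₀ z ⟨hzB, hz⟩]
  · -- the local form of [BernsteinLapid2019, §2.1]
    refine ⟨Metric.ball s₀ (ε s₀ hs₀), Metric.ball_mem_nhds s₀ (hε s₀ hs₀), f s₀ hs₀, u s₀ hs₀, hf s₀ hs₀, hu s₀ hs₀,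
      (hclos s₀ _ _ (hf s₀ hs₀) (hne s₀ hs₀) s₀ (Metric.mem_ball_self (hε s₀ hs₀))).1, fun s hs hfs => ⟨?_, (hspec s₀ hs₀ s hs hfs).2⟩⟩
    exact Set.mem_iUnion₂.2 ⟨s₀, hs₀, hs, hfs⟩

end Summit.HodgeConjecture.HodgeConjecture.Cruxes.H413.K2E1MeromorphicSolutionPrinciple

end
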